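import Literature.MathematicalPhysics.QuantumFieldTheory.Balaban1983to89.B1Prop22RegularFieldAlg
import Literature.MathematicalPhysics.QuantumFieldTheory.Balaban1983to89.B4GaussRep36

/-!
# `Balaban1983to89.B4Cor23Rep36Bridge` — T. Bałaban, *Regularity and decay of lattice Green's functions*, Commun. Math.
# Phys. **89** (1983) 571–597 [Balaban1983RegularityDecay]: the plain-matrix dictionary of `B4GaussRep36` ((1.6) `kForm`/`gk`,
# (1.14) `deltaK`) INSTANTIATED on the B4 cell's regular-field region carriers (`B4Lemma21Region.regionOp`), and the
# Corollary-2.3 input `hG` of the §5/§3 routes of Proposition I.2.3 (`B4Prop23Sect5Route`, `B4Prop23BlockAvg`) DISCHARGED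
# at every regular `A ≠ 0` from `B4Cor23Region.cor23_pairings_set_region`

statement-level skeleton of published theorems with citation tags; proofs where landed; nothing here is a claim about the Yang–Mills mass gap

PDF held: `paper:balaban1983-cmp89-regularity-decay` (journal page = PDF page + 570), pp. 572–573, 580–581, 593–594 read
as images on `run/shared/lean/pub/pub-balaban/b2b-balaban-ref1/pages/1983-cmp89-regularity-decay/…-p002, p003, p010, p011,
p023, p024-x2.png`.

CITATION HEADER (lean-in-tree rule).  Cell `lit-balaban` (HOME `run/shared/lean/pub/lit-balaban/`), Phase-2 proof seat
**p17** gen 2 (unit `lit-balaban-p17-g2`); an INTERFACE BRIDGE for rows **B4.Cor2.3**, **B4.Eq1.14**, **B4.Eq5.4** and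
**B4.Prop2.3[I]** (owner r01, referee ref-4): no row decl is restated; two existing typings of ONE printed object are proved
equal and one displayed hypothesis of an existing theorem is discharged on a concrete family.  USED BY NAME, never
restated: `B4GaussRep36.{kForm, gk, deltaK, kForm_covOp}` (r01/pv lineage: (1.6), (1.14) as plain matrices on
`X = sites × components`), `B4Lemma21Region.regionOp` + `B4Cor23RegionDeltaAlg.{lnk, trn, regionOp_eq}` (b04: (1.6) with the
block transporters along the staircase contours), `B4Cor23Region.cor23_pairings_set_region` (b04: Cor. 2.3 (2.30) at `A ≠ 0`
in set form, constants `c0R a`, `delta0R d a`), `B1Prop22RegularFieldAlg.{avgR, deltaK}` (p17: (1.14) = I (2.21) on the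
region data).

WHAT IS PRINTED (verbatim).  p. 572: *"(−Δ^{η,N}_{A,Ω} + m² + a_kP_k(A))^{−1} = G_k(Ω, A) (1.6)"*, p. 573: *"Δ^{(k)}(Ω, A) =
a_kI − a_k²Q_k(A)G_k(Ω, A)Q_k^*(A) (1.14)"*, p. 580: *"|⟨f, G_k(Ω,A)f′⟩| […] ≦ c₀e^{−δ₀dist(supp f, supp f′)}‖f‖₂‖f′‖₂
(2.30)"*, p. 593: *"Finally Corollary 2.3 implies that the considered operator is short-ranged … (5.4)"*.

DICTIONARY.  r01's `H` ↤ `hamR = covLap (regWt …) (lnk …) + m²·1` (the form matrix of `−Δ^{η,N}_{A,Ω} + m²`, counting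
pairing, lattice units); r01's `Qk = avgOp qk Tk` ↤ `avgOp (qkR n Ωc) (trn …)` with the block weight `qk(y,x) =
η^{(d+1)/2}·1[x ∈ B(y)]` (`qkR`; so that `a_kQ_kᵀQ_k = a_kη^{d+1}·QᵀQ` is b04's `a_k n^{−(d+1)}·P`, `QkR_eq`) and the block
transporters `Tk = trn`; r01's `blk` ↤ `blkR` (the label of the block of a fine point); `nrm` ↤ the counting norm `bl2n`
(`κ = 1`); `sdist U U′` ↤ `sdistR` = the η-distance of the site projections of `U, U′ ⊆ X`.

WHAT IS PROVED (kernel-checked, zero `sorry`, no `def … : Prop`; axioms standard).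
* §1 `QkR_eq` (`avgOp qkR trn = η^{(d+1)/2}·avgR`), **`kForm_eq_regionOp`** (r01's `kForm hamR a QkR` IS b04's `regionOp`),
  **`gk_eq_green`** (r01's `gk` IS `G_k(Ω,A) = (regionOp …)⁻¹`), **`deltaK_rep36_eq`** (r01's `B4GaussRep36.deltaK hamR a QkR`
  IS p17's `B1Prop22RegularFieldAlg.deltaK`, i.e. ONE (1.14), two letters, proved equal).
* §2 r01's STRUCTURAL hypotheses for this data: `qkR_off` (`hqk`), `qkR_diag` (`hqkc`, `c = η^{(d+1)/2}`), `card_blkR`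
  (`hcardk`, `nk = n^{d+1}`), `trn_mul_transpose` (`hTk`, orthogonal transporters), `hamR_isSymm` (`hH`), `bl2n_sq` (`hn2`,
  `κ = 1`).
* §3 **`hG_regularPair`**: r01's ANALYTIC input `hG` of `B4Prop23Sect5Route.abs_kOp_apply_le(_exp)` /
  `prop23_116_118_of_cor23` / `B4Prop23BlockAvg.prop23_116_118_blockAvg_sect5` — *«|⟨g, G_k(Ω,A)g′⟩| ≤
  c‖g‖‖g′‖e^{−δ·sdist(U,U′)}` for `g, g′` supported in `U, U′`»* — HOLDS for `gk hamR a QkR` on EVERY regular-field region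
  instance (every mesh, every finite union of unit blocks, every `m² ≥ 0`, every vector field with (1.7) on `Ω`, `e` below
  b04's threshold), with `c = c0R a`, `δ = delta0R d a`: b04's Corollary 2.3 at `A ≠ 0`.
HONEST SCOPE: the remaining displayed inputs of r01's routes (the lower bound (5.3) `hlow`/`hKU`, the `L²` bound `hG0` of
the NEXT-scale propagator, the pseudo-distance geometry `hρS`/`hρP`) are NOT touched here.  Value = interface certificate.
-/

namespace Literature.MathematicalPhysics.QuantumFieldTheory.Balaban1983to89.B4Cor23Rep36Bridge

open Finset Matrix
open Literature.MathematicalPhysics.QuantumFieldTheory.Balaban1983to89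
open Literature.MathematicalPhysics.QuantumFieldTheory.Balaban1983to89.B4GaugeCovariance (OrthFlow avgOp blockOp_apply
  covLap contourTrans)
open Literature.MathematicalPhysics.QuantumFieldTheory.Balaban1983to89.B4Lower18 (fineDom mem_fineDom fineDom_isBlockUnion
  edistR rblk card_filter_rblk)
open Literature.MathematicalPhysics.QuantumFieldTheory.Balaban1983to89.B4Lower18Regular (transport_fieldLink e1
  dotProduct_self_nonneg')
open Literature.MathematicalPhysics.QuantumFieldTheory.Balaban1983to89.B4Lower18RegularRegion (regWt rBlkWt rbaseEmb
  rstairContour compField)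
open Literature.MathematicalPhysics.QuantumFieldTheory.Balaban1983to89.B4Lemma21Region (regionOp)
open Literature.MathematicalPhysics.QuantumFieldTheory.Balaban1983to89.B4Reflection242 (blk)
open Literature.MathematicalPhysics.QuantumFieldTheory.Balaban1983to89.B4Cor23ZeroDelta (setDist setDist_le)
open Literature.MathematicalPhysics.QuantumFieldTheory.Balaban1983to89.B4Cor23Region (bl2n c0R delta0R
  cor23_pairings_set_region)
open Literature.MathematicalPhysics.QuantumFieldTheory.Balaban1983to89.B4Cor23RegionDeltaAlg (lnk trn regionOp_eq
  covLap_transpose)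
open Literature.MathematicalPhysics.QuantumFieldTheory.Balaban1983to89.B4GaussRep36 (kForm gk)
open Literature.MathematicalPhysics.QuantumFieldTheory.Balaban1983to89.B1Prop22RegularFieldAlg (avgR deltaK_eq)

noncomputable section

variable {d : ℕ} {ι : Type} [Fintype ι] [DecidableEq ι]

/-! ## §1. The `B4GaussRep36` dictionary on the region carriers -/

section Dictionary

variable (F : OrthFlow ι) (e : ℝ) {n : ℕ} (hn : 1 ≤ n) (a m2 : ℝ) (Ωc : Finset (Fin (d + 1) → ℤ))
  (Ac : (Fin (d + 1) → ℤ) → Fin (d + 1) → ℝ)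

/-- r01's `H`: the form matrix of `−Δ^{η,N}_{A,Ω} + m²` on the fine points of `Ω` (counting pairing, lattice units).
[cite: Balaban1983RegularityDecay, p. 572 (1.3), (1.6)] -/
abbrev hamR (n : ℕ) : Matrix (↥(fineDom n Ωc) × ι) (↥(fineDom n Ωc) × ι) ℝ :=
  covLap (regWt n (fineDom n Ωc)) (lnk F e n Ωc Ac) + m2 • (1 : Matrix _ _ ℝ)

/-- r01's block weight `qk(y,x) = η^{(d+1)/2}·1[x ∈ B(y)]` (the `η^{d+1}` of `Q_k^*Q_k` split evenly, DICTIONARY).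
[cite: Balaban1983RegularityDecay, p. 572 (1.4)] -/
def qkR (n : ℕ) (Ωc : Finset (Fin (d + 1) → ℤ)) (y : ↥Ωc) (x : ↥(fineDom n Ωc)) : ℝ :=
  Real.sqrt (((n : ℝ) ^ (d + 1))⁻¹) * rBlkWt n Ωc (fineDom n Ωc) y x

/-- r01's `Qk = avgOp qk Tk` on the region data: weights `qkR`, transporters `U(A(Γ_{y,x}))` (`trn`).
[cite: Balaban1983RegularityDecay, p. 572 (1.4)] -/
abbrev QkR : Matrix (↥Ωc × ι) (↥(fineDom n Ωc) × ι) ℝ := avgOp (qkR n Ωc) (trn F e hn Ωc Ac)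

/-- `Qk = η^{(d+1)/2}·Q` with `Q = avgR` the transported block sums. [cite: Balaban1983RegularityDecay, p. 572 (1.4)] -/
theorem QkR_eq : QkR F e hn Ωc Ac = Real.sqrt (((n : ℝ) ^ (d + 1))⁻¹) • avgR F e hn Ωc Ac := by
  ext ⟨y, i⟩ ⟨x, j⟩
  simp only [avgOp, blockOp_apply, Matrix.smul_apply, smul_eq_mul, qkR, mul_assoc]

/-- **r01's `kForm H a_k Q_k` (1.6) IS b04's `regionOp`** (`−Δ^{η,N}_{A,Ω} + m² + a_kP_k(A)` with the staircase transporters).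
[cite: Balaban1983RegularityDecay, p. 572 (1.6)] -/
theorem kForm_eq_regionOp :
    kForm (hamR F e m2 Ωc Ac n) a (QkR F e hn Ωc Ac) = regionOp F e hn a m2 Ωc Ac := by
  have hs : (0 : ℝ) ≤ ((n : ℝ) ^ (d + 1))⁻¹ := by positivity
  rw [regionOp_eq, kForm, QkR_eq, Matrix.transpose_smul, Matrix.smul_mul, Matrix.mul_smul, smul_smul, smul_smul,
    mul_assoc, Real.mul_self_sqrt hs]
  rfl

/-- **r01's `gk H a_k Q_k` IS `G_k(Ω,A) = (regionOp …)⁻¹`.** [cite: Balaban1983RegularityDecay, p. 572 (1.6)] -/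
theorem gk_eq_green : gk (hamR F e m2 Ωc Ac n) a (QkR F e hn Ωc Ac) = (regionOp F e hn a m2 Ωc Ac)⁻¹ := by
  rw [gk, kForm_eq_regionOp]

/-- **ONE (1.14), TWO LETTERS, PROVED EQUAL**: r01's plain-matrix `B4GaussRep36.deltaK H a_k Q_k` on the region data IS p17's
`B1Prop22RegularFieldAlg.deltaK` (`a_kI − a_k²Q_k(A)G_k(Ω,A)Q_k^*(A)` with b04's transporters). [cite: Balaban1983RegularityDecay, p. 573 (1.14)] -/
theorem deltaK_rep36_eq :
    B4GaussRep36.deltaK (hamR F e m2 Ωc Ac n) a (QkR F e hn Ωc Ac)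
      = B1Prop22RegularFieldAlg.deltaK F e hn a m2 Ωc Ac := by
  have hs : (0 : ℝ) ≤ ((n : ℝ) ^ (d + 1))⁻¹ := by positivity
  rw [B4GaussRep36.deltaK, gk_eq_green, QkR_eq, deltaK_eq, Matrix.transpose_smul, Matrix.smul_mul, Matrix.smul_mul,
    Matrix.mul_smul, smul_smul, smul_smul, mul_assoc, Real.mul_self_sqrt hs]

/-! ## §2. r01's structural hypotheses on the region data -/

/-- r01's `blk`: the label of the block of a fine point of `Ω`. [cite: Balaban1983RegularityDecay, p. 572 (1.1)] -/
def blkR {n : ℕ} (hn : 1 ≤ n) (Ωc : Finset (Fin (d + 1) → ℤ)) (x : ↥(fineDom n Ωc)) : ↥Ωc :=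
  ⟨blk n x.1, (mem_fineDom hn).1 x.2⟩

/-- `hqk`: the weight vanishes off the block. [cite: Balaban1983RegularityDecay, p. 572 (1.4)] -/
theorem qkR_off (y : ↥Ωc) (x : ↥(fineDom n Ωc)) (h : blkR hn Ωc x ≠ y) : qkR n Ωc y x = 0 := by
  unfold qkR rBlkWt
  rw [if_neg, mul_zero]
  exact fun hb => h (Subtype.ext hb)

/-- `hqkc`: the weight on the block is the constant `η^{(d+1)/2}`. [cite: Balaban1983RegularityDecay, p. 572 (1.4)] -/
theorem qkR_diag (x : ↥(fineDom n Ωc)) : qkR n Ωc (blkR hn Ωc x) x = Real.sqrt (((n : ℝ) ^ (d + 1))⁻¹) := by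
  unfold qkR rBlkWt blkR
  rw [if_pos rfl, mul_one]

/-- `hcardk`: every block of `Ω` has `n^{d+1}` fine points. [cite: Balaban1983RegularityDecay, p. 572 (1.1)] -/
theorem card_blkR (y : ↥Ωc) : (univ.filter fun x : ↥(fineDom n Ωc) => blkR hn Ωc x = y).card = n ^ (d + 1) := by
  have hy : y.1 ∈ (fineDom n Ωc).image (blk n) :=
    Finset.mem_image.2 ⟨(rbaseEmb hn Ωc y).1, (rbaseEmb hn Ωc y).2, B4Lower18RegularRegion.rbaseEmb_blk hn Ωc y⟩
  have h := card_filter_rblk hn (fineDom_isBlockUnion hn Ωc) ⟨y.1, hy⟩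
  rw [Finset.filter_congr (fun x _ => show rblk n _ x = ⟨y.1, hy⟩ ↔ blkR hn Ωc x = y by
    rw [Subtype.ext_iff, Subtype.ext_iff]; exact Iff.rfl)] at h
  exact h

/-- `hTk`: the block transporters are orthogonal, `U(A(Γ))U(A(Γ))ᵀ = 1`. [cite: Balaban1983RegularityDecay, p. 572 (1.2), (1.4)] -/
theorem trn_mul_transpose (y : ↥Ωc) (x : ↥(fineDom n Ωc)) :
    trn F e hn Ωc Ac y x * (trn F e hn Ωc Ac y x)ᵀ = 1 := by
  unfold trn lnk contourTrans
  rw [transport_fieldLink, F.transpose_eq, ← F.map_add, add_neg_cancel, F.map_zero]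

/-- `hH`: the form matrix of `−Δ^{η,N}_{A,Ω} + m²` is symmetric. [cite: Balaban1983RegularityDecay, p. 572 (1.3)] -/
theorem hamR_isSymm : (hamR F e m2 Ωc Ac n).IsSymm := by
  unfold Matrix.IsSymm
  rw [Matrix.transpose_add, covLap_transpose, Matrix.transpose_smul, Matrix.transpose_one]

omit [DecidableEq ι] in
/-- `hn2` with `κ = 1`: the counting norm squared is the self-pairing. [cite: Balaban1983RegularityDecay, (2.30) p. 580 «‖f‖₂»] -/
theorem bl2n_sq {J : Type} [Fintype J] (u : J → ℝ) : bl2n u ^ 2 = 1 * (u ⬝ᵥ u) := by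
  rw [one_mul, bl2n, Real.sq_sqrt (dotProduct_self_nonneg' u)]

/-- r01's `sdist U U′`: the η-distance between the site projections of two index sets (`0` if one is empty).
[cite: Balaban1983RegularityDecay, (2.30) p. 580 «dist(supp f, supp f′)»] -/
def sdistR (n : ℕ) (Ωc : Finset (Fin (d + 1) → ℤ)) (U U' : Finset (↥(fineDom n Ωc) × ι)) : ℝ :=
  setDist (edistR n (fineDom n Ωc)) (U.image Prod.fst) (U'.image Prod.fst)

end Dictionary

/-! ## §3. The Corollary-2.3 input `hG` of the §5/§3 routes, discharged at regular `A ≠ 0` -/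

section Discharge

variable (F : OrthFlow ι) {ℓ : ℝ} (hℓ : 0 ≤ ℓ)
  (hLip : ∀ t (v : ι → ℝ), ((F.U t - 1) *ᵥ v) ⬝ᵥ ((F.U t - 1) *ᵥ v) ≤ (ℓ * t) ^ 2 * (v ⬝ᵥ v))
  {e : ℝ} (he : 0 < e) {n : ℕ} (hn : 1 ≤ n) {a : ℝ} (ha : 0 < a) {m2 : ℝ} (hm : 0 ≤ m2)
  (Ωc : Finset (Fin (d + 1) → ℤ)) {Ac : (Fin (d + 1) → ℤ) → Fin (d + 1) → ℝ} {c β : ℝ} (hc : 0 ≤ c)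
  (h17 : ∀ x ∈ fineDom n Ωc, ∀ μ ν : Fin (d + 1), |Ac (x + e1 μ) ν - Ac x ν| ≤ c * e ^ (β - 1) / n)
  (hsmall : ℓ ^ 2 * ((d + 1) * c * e ^ β) ^ 2 * (d + 1) * (1 + a * (d + 1)) ≤ min 2 a / 4)

include hℓ hLip he ha hm hc h17 hsmall in
/-- **r01's HYPOTHESIS `hG` HOLDS ON THE REGULAR-FIELD REGION CARRIERS**: under (1.7) on `Ω` and b04's smallness of `e`, for
every flow with `‖(U(t)−1)v‖ ≤ ℓt‖v‖`, `a > 0`, `m² ≥ 0`, every mesh and every finite union `Ω` of unit blocks, for all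
`g, g′` supported in `U, U′ ⊆ Ω × {1,…,N}`:
`|⟨g, gk(H,a_k,Q_k)g′⟩| ≤ c0R(a)·‖g‖₂‖g′‖₂·e^{−delta0R(d,a)·sdist(U,U′)}` — Corollary 2.3 (2.30) for `G_k(Ω,A)` in the shape
consumed by `B4Prop23Sect5Route.abs_kOp_apply_le` / `B4Prop23BlockAvg.prop23_116_118_blockAvg_sect5` (`nrm = ‖·‖₂`,
`κ = 1`). [cite: Balaban1983RegularityDecay, Cor. 2.3 (2.30) p. 580; (5.4) p. 593] -/
theorem hG_regularPair (g g' : ↥(fineDom n Ωc) × ι → ℝ) (U U' : Finset (↥(fineDom n Ωc) × ι))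
    (hg : ∀ x ∉ U, g x = 0) (hg' : ∀ x ∉ U', g' x = 0) :
    |g ⬝ᵥ (gk (hamR F e m2 Ωc Ac n) a (QkR F e hn Ωc Ac) *ᵥ g')|
      ≤ c0R a * bl2n g * bl2n g' * Real.exp (-(delta0R d a * sdistR n Ωc U U')) := by
  obtain ⟨h0, h1, hct⟩ := B4Cor23Region.delta0R_admissible d ha
  have hgS : ∀ j : ↥(fineDom n Ωc) × ι, j.1 ∉ U.image Prod.fst → g j = 0 :=
    fun j hj => hg j fun hjU => hj (Finset.mem_image_of_mem Prod.fst hjU)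
  have hgS' : ∀ j : ↥(fineDom n Ωc) × ι, j.1 ∉ U'.image Prod.fst → g' j = 0 :=
    fun j hj => hg' j fun hjU => hj (Finset.mem_image_of_mem Prod.fst hjU)
  have h := (cor23_pairings_set_region F hℓ hLip he hn ha hm Ωc hc h17 hsmall h0 h1 hct (U.image Prod.fst)
    (U'.image Prod.fst) (sdistR n Ωc U U') (fun x hx t ht => setDist_le _ hx ht) g g' hgS hgS' 0 0).1
  rw [gk_eq_green]
  calc _ ≤ c0R a * Real.exp (-(delta0R d a * sdistR n Ωc U U')) * bl2n g * bl2n g' := h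
    _ = _ := by ring

end Discharge

end

end Literature.MathematicalPhysics.QuantumFieldTheory.Balaban1983to89.B4Cor23Rep36Bridge
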